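import Literature.Topology.FourManifolds.MappingTorus
import Literature.Topology.FourManifolds.GluingUniqueness
import HarnessLib

/-!
# A smooth mapping torus is homeomorphic to the topological mapping torus

Sibling proof file of `MappingTorus.lean` (D-0014: named facts `def X : Prop` are discharged as
`theorem X_holds : X`). It discharges

* `Literature.nonempty_homeomorph_mappingTorus_of_isMappingTorusOf_holds :
  nonempty_homeomorph_mappingTorus_of_isMappingTorusOf` — if the manifold `T` is a smooth mapping
  torus of the diffeomorphism `φ` (`Literature.IsMappingTorusOf IT T φ`, i.e. an open gluing of the
  cylinders `A = M × (0, 1)` and `B = M × (1/2, 3/2)` along `Literature.mappingTorusRel φ`), then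
  `T ≃ₜ Literature.MappingTorus φ.toHomeomorph = M × ℝ / (x, t) ∼ (φ x, t + 1)`.
* `Literature.nonempty_diffeomorph_of_isMappingTorusOf_holds : nonempty_diffeomorph_of_isMappingTorusOf`
  (last section) — two smooth mapping tori `T`, `T'` of the same `φ` are diffeomorphic: they are
  open gluings of the same cylinders along the same relation, so the uniqueness of open gluings
  `Literature.Topology.FourManifolds.IsOpenGluing.nonempty_diffeomorph` (`GluingUniqueness.lean`; Kosinski, *Differential
  Manifolds* (1993), Ch. VI §1, proof of Thm (1.1): the identification space carries "the unique
  structure for which the projections are diffeomorphisms") applies verbatim.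
* `Literature.Topology.FourManifolds.IsMappingTorusOf.compactSpace_holds : IsMappingTorusOf.compactSpace`
  (appended 2026-09-05) — a smooth mapping torus of a compact manifold is compact: transport of
  the instance `MappingTorus.compactSpace_mappingTorus` along the homeomorphism of the first item
  (`IsMappingTorusOf.compactSpace_of_isMappingTorusOf`; Cappell–Shaneson 1976, §1).

Source. Hatcher, *Algebraic Topology* (2002), Ch. 1 §1.2 Ex. 11 and Ch. 2 Example 2.48, defines
the mapping torus of `f : X → X` as the quotient of `X × I` by `(x, 0) ∼ (f x, 1)`; Cappell–Shaneson,
*Some new four-manifolds*, Ann. of Math. 104 (1976), §1, use `M × ℝ / (x, t) ∼ (φ x, t + 1)`.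
The printed sources contain no proof of the present statement, which is the routine point-set
verification that the two-cylinder atlas of `IsMappingTorusOf` presents the same quotient; we
record the argument here.

Proof. Let `jA : A → T`, `jB : B → T` be the gluing maps (open topological embeddings covering
`T`, with `jA a = jB b ↔ mappingTorusRel φ a b`) and `qA : A → T_φ`, `qB : B → T_φ` the
restrictions of the quotient map `q : M × ℝ → T_φ`.
1. `q` is an open map (`MappingTorus.isOpenMap_mk`): the saturation of an open `U ⊆ M × ℝ` is
   `⋃ₖ ψₖ ⁻¹' U` for the deck homeomorphisms `ψₖ (x, t) = (φᵏ x, t + k)`. Hence `qA`, `qB` are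
   open maps; they are injective since two levels in `(0, 1)` (resp. `(1/2, 3/2)`) differing by an
   integer are equal (`MappingTorus.mk_eq_mk_iff_of_abs_sub_lt_one`), and
   `qA a = qB b ↔ mappingTorusRel φ a b` (`MappingTorus.mk_eq_mk_iff_mappingTorusRel`, proved in
   `MappingTorus.lean`).
2. Define `f : T → T_φ` by `f (jA a) = qA a`, `f (jB b) = qB b`; this is well defined and
   injective because `jA a = jB b ↔ mappingTorusRel φ a b ↔ qA a = qB b`, and surjective because
   every class has a representative `(x, t)` with `t ∈ [0, 1)`, where `(x, 0) ∼ (φ x, 1)` and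
   `1 ∈ (1/2, 3/2)`.
3. `f` is continuous and open at `jA a` since `jA` is an open embedding
   (`IsOpenEmbedding.continuousAt_iff`, `IsOpenEmbedding.map_nhds_eq`) and `f ∘ jA = qA` is
   continuous and open; likewise at `jB b`. A continuous open bijection is a homeomorphism.
Only the topological content of `IsMappingTorusOf` is used (smooth embeddings are topological
embeddings, `Manifold.IsSmoothEmbedding.isEmbedding`); the purely topological statement is
`Literature.Topology.FourManifolds.nonempty_homeomorph_mappingTorus_of_isOpenEmbedding`.
-/

open scoped Manifold ContDiff Topology
open Set Function Filter Topology

noncomputable section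

namespace Literature.Topology.FourManifolds

namespace MappingTorus

variable {M : Type*} [TopologicalSpace M] (φ : M ≃ₜ M)

/-- The `k`-th iterate of `φ` as a permutation is the `k`-th iterate of `φ` as a homeomorphism:
`⇑(φ.toEquiv ^ k) = ⇑(φ ^ k)`; in particular it is continuous. (`Homeomorph.toEquiv` is a
monoid homomorphism `(M ≃ₜ M) →* Equiv.Perm M`, both groups composing right-to-left, used to
identify the iterates `φ.toEquiv ^ k` appearing in `mappingTorusSetoid` with the homeomorphisms
`φ ^ k`.) [folklore] -/
theorem coe_toEquiv_zpow (k : ℤ) : ⇑(φ.toEquiv ^ k) = ⇑(φ ^ k) := by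
  have h := map_zpow
    (MonoidHom.mk' (Homeomorph.toEquiv : (M ≃ₜ M) → Equiv.Perm M) fun _ _ => rfl) φ k
  simp only [MonoidHom.mk'_apply] at h
  rw [← h, Homeomorph.coe_toEquiv]

/-- The deck transformations `ψₖ (x, t) = (φᵏ x, t + k)` of `M × ℝ → T_φ` are continuous
(Hatcher, *Algebraic Topology*, §1.3, deck transformations of the covering `M × ℝ → T_φ`). [folklore] -/
theorem continuous_deck (k : ℤ) :
    Continuous fun p : M × ℝ => ((φ.toEquiv ^ k) p.1, p.2 + (k : ℝ)) := by
  rw [coe_toEquiv_zpow]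
  fun_prop

/-- The deck transformations do not change the class in `T_φ`: `[(φᵏ x, t + k)] = [(x, t)]`
(Hatcher, *Algebraic Topology*, Ex. 2.48). [folklore] -/
theorem mk_deck (k : ℤ) (p : M × ℝ) :
    mk φ ((φ.toEquiv ^ k) p.1) (p.2 + (k : ℝ)) = mk φ p.1 p.2 :=
  mk_zpow_apply_add_intCast φ p.1 p.2 k

/-- The saturation of a set `U ⊆ M × ℝ` under the mapping torus relation is the union of its
preimages under the deck transformations `ψₖ (x, t) = (φᵏ x, t + k)`, `k : ℤ`
(Hatcher, *Algebraic Topology*, Ex. 2.48). [folklore] -/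
theorem preimage_image_mk (U : Set (M × ℝ)) :
    (fun p : M × ℝ => mk φ p.1 p.2) ⁻¹' ((fun p : M × ℝ => mk φ p.1 p.2) '' U) =
      ⋃ k : ℤ, (fun p : M × ℝ => ((φ.toEquiv ^ k) p.1, p.2 + (k : ℝ))) ⁻¹' U := by
  ext ⟨y, t⟩
  simp only [mem_preimage, mem_image, mem_iUnion, Prod.exists]
  constructor
  · rintro ⟨x, s, hxU, hxy⟩
    obtain ⟨k, ht, hy⟩ := (mk_eq_mk_iff φ).1 hxy
    refine ⟨-k, ?_⟩
    have hx : (φ.toEquiv ^ (-k)) y = x := by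
      rw [hy, ← Equiv.Perm.mul_apply, ← zpow_add, neg_add_cancel, zpow_zero,
        Equiv.Perm.one_apply]
    have hs : t + ((-k : ℤ) : ℝ) = s := by rw [ht]; push_cast; ring
    rwa [hx, hs]
  · rintro ⟨k, hk⟩
    exact ⟨_, _, hk, mk_deck φ k (y, t)⟩

/-- **The quotient map `M × ℝ → T_φ` is open**: the saturation of an open set is a union of
translates by the deck homeomorphisms (Hatcher, *Algebraic Topology*, Ex. 2.48 and §1.3). [folklore] -/
theorem isOpenMap_mk : IsOpenMap fun p : M × ℝ => mk φ p.1 p.2 := by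
  intro U hU
  rw [← (isQuotientMap_mk φ).isOpen_preimage, preimage_image_mk]
  exact isOpen_iUnion fun k => hU.preimage (continuous_deck φ k)

/-- Two points `(x, s)`, `(y, t)` of `M × ℝ` at levels less than `1` apart have the same class in
`T_φ` iff they are equal: the only integer `k` with `t = s + k`, `|t - s| < 1` is `0`
(Hatcher, *Algebraic Topology*, Ex. 2.48). [folklore] -/
theorem mk_eq_mk_iff_of_abs_sub_lt_one {x y : M} {s t : ℝ} (h : |t - s| < 1) :
    mk φ x s = mk φ y t ↔ x = y ∧ s = t := by
  constructor
  · intro hxy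
    obtain ⟨k, ht, hy⟩ := (mk_eq_mk_iff φ).1 hxy
    have hk : |(k : ℝ)| < 1 := by rwa [ht, add_sub_cancel_left] at h
    have hk0 : k = 0 := by
      rw [← Int.cast_abs, ← Int.cast_one, Int.cast_lt, Int.abs_lt_one_iff] at hk
      exact hk
    subst hk0
    exact ⟨by simpa using hy.symm, by simpa using ht.symm⟩
  · rintro ⟨rfl, rfl⟩
    rfl

/-- The quotient map restricted to the first cylinder `A = M × (0, 1)`, `(x, s) ↦ [(x, s)]`, is
injective (Hatcher, *Algebraic Topology*, Ex. 2.48). [folklore] -/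
theorem injective_mk_pieceOne :
    Injective fun a : M × mappingTorusPieceOne => mk φ a.1 a.2 := by
  rintro ⟨x, s, hs⟩ ⟨y, t, ht⟩ hxy
  have hs' : 0 < s ∧ s < 1 := hs
  have ht' : 0 < t ∧ t < 1 := ht
  have habs : |t - s| < 1 := abs_sub_lt_iff.2 ⟨by linarith, by linarith⟩
  obtain ⟨rfl, hst⟩ := (mk_eq_mk_iff_of_abs_sub_lt_one φ habs).1 hxy
  subst hst
  rfl

/-- The quotient map restricted to the second cylinder `B = M × (1/2, 3/2)`, `(y, t) ↦ [(y, t)]`,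
is injective (Hatcher, *Algebraic Topology*, Ex. 2.48). [folklore] -/
theorem injective_mk_pieceTwo :
    Injective fun b : M × mappingTorusPieceTwo => mk φ b.1 b.2 := by
  rintro ⟨x, s, hs⟩ ⟨y, t, ht⟩ hxy
  have hs' : 1 / 2 < s ∧ s < 3 / 2 := hs
  have ht' : 1 / 2 < t ∧ t < 3 / 2 := ht
  have habs : |t - s| < 1 := abs_sub_lt_iff.2 ⟨by linarith, by linarith⟩
  obtain ⟨rfl, hst⟩ := (mk_eq_mk_iff_of_abs_sub_lt_one φ habs).1 hxy
  subst hst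
  rfl

/-- The quotient map restricted to the open cylinder `A = M × (0, 1)` is an open map
(Hatcher, *Algebraic Topology*, Ex. 2.48). [folklore] -/
theorem isOpenMap_mk_pieceOne :
    IsOpenMap fun a : M × mappingTorusPieceOne => mk φ a.1 a.2 :=
  (isOpenMap_mk φ).comp
    (IsOpenMap.id.prodMap mappingTorusPieceOne.isOpen.isOpenMap_subtype_val)

/-- The quotient map restricted to the open cylinder `B = M × (1/2, 3/2)` is an open map
(Hatcher, *Algebraic Topology*, Ex. 2.48). [folklore] -/
theorem isOpenMap_mk_pieceTwo :
    IsOpenMap fun b : M × mappingTorusPieceTwo => mk φ b.1 b.2 :=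
  (isOpenMap_mk φ).comp
    (IsOpenMap.id.prodMap mappingTorusPieceTwo.isOpen.isOpenMap_subtype_val)

/-- The quotient map restricted to the cylinder `A = M × (0, 1)` is continuous
(Hatcher, *Algebraic Topology*, Ex. 2.48). [folklore] -/
theorem continuous_mk_pieceOne :
    Continuous fun a : M × mappingTorusPieceOne => mk φ a.1 a.2 :=
  (continuous_mk φ).comp (continuous_id.prodMap continuous_subtype_val)

/-- The quotient map restricted to the cylinder `B = M × (1/2, 3/2)` is continuous
(Hatcher, *Algebraic Topology*, Ex. 2.48). [folklore] -/
theorem continuous_mk_pieceTwo :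
    Continuous fun b : M × mappingTorusPieceTwo => mk φ b.1 b.2 :=
  (continuous_mk φ).comp (continuous_id.prodMap continuous_subtype_val)

end MappingTorus

section Topological

variable {M : Type*} [TopologicalSpace M] {T : Type*} [TopologicalSpace T]

/-- **Recognition of the mapping torus, topological form.** If `T` is covered by open
topological embeddings `jA : M × (0, 1) → T`, `jB : M × (1/2, 3/2) → T` of the two cylinders which
identify exactly the `mappingTorusRel φ`-related points, then `T ≃ₜ T_φ = M × ℝ / (x, t) ∼ (φ x, t + 1)`:
the map `T → T_φ` given by the quotient map on each cylinder is a well defined continuous open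
bijection (module docstring, steps 1–3) (Hatcher, *Algebraic Topology* (2002), Ch. 2 Example 2.48
for the mapping torus; the verification is routine and not printed there). [cite: HatcherAT2002, Ex. 2.48] -/
theorem nonempty_homeomorph_mappingTorus_of_isOpenEmbedding (φ : M ≃ₜ M)
    {jA : M × mappingTorusPieceOne → T} {jB : M × mappingTorusPieceTwo → T}
    (hA : IsOpenEmbedding jA) (hB : IsOpenEmbedding jB) (hU : range jA ∪ range jB = univ)
    (hR : ∀ a b, jA a = jB b ↔ mappingTorusRel φ a b) :
    Nonempty (T ≃ₜ MappingTorus φ) := by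
  classical
  -- the quotient map on the two cylinders
  set qA : M × mappingTorusPieceOne → MappingTorus φ := fun a => MappingTorus.mk φ a.1 a.2
    with hqA_def
  set qB : M × mappingTorusPieceTwo → MappingTorus φ := fun b => MappingTorus.mk φ b.1 b.2
    with hqB_def
  have hqAB : ∀ a b, qA a = qB b ↔ jA a = jB b := fun a b => by
    rw [hR, hqA_def, hqB_def, MappingTorus.mk_eq_mk_iff_mappingTorusRel]
  have hcover : ∀ p, p ∈ range jA ∨ p ∈ range jB := fun p => by
    simpa only [← mem_union, hU] using mem_univ p
  -- the comparison map
  set f : T → MappingTorus φ := fun p =>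
    if h : p ∈ range jA then qA (Classical.choose h)
    else qB (Classical.choose ((hcover p).resolve_left h)) with hf_def
  have hfA : ∀ a, f (jA a) = qA a := fun a => by
    have h : jA a ∈ range jA := mem_range_self a
    rw [hf_def]
    dsimp only
    rw [dif_pos h]
    congr 1
    exact hA.injective (Classical.choose_spec h)
  have hfB : ∀ b, f (jB b) = qB b := fun b => by
    by_cases h : jB b ∈ range jA
    · obtain ⟨a, ha⟩ := h
      rw [← ha, hfA, hqAB, ha]
    · rw [hf_def]
      dsimp only
      rw [dif_neg h]
      congr 1
      exact hB.injective (Classical.choose_spec ((hcover (jB b)).resolve_left h))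
  have hfA' : f ∘ jA = qA := funext hfA
  have hfB' : f ∘ jB = qB := funext hfB
  -- continuity
  have hcont : Continuous f := by
    refine continuous_iff_continuousAt.2 fun p => ?_
    obtain ⟨a, rfl⟩ | ⟨b, rfl⟩ := hcover p
    · exact hA.continuousAt_iff.1
        (hfA' ▸ (MappingTorus.continuous_mk_pieceOne φ).continuousAt)
    · exact hB.continuousAt_iff.1
        (hfB' ▸ (MappingTorus.continuous_mk_pieceTwo φ).continuousAt)
  -- openness
  have hopen : IsOpenMap f := by
    refine IsOpenMap.of_nhds_le fun p => ?_
    obtain ⟨a, rfl⟩ | ⟨b, rfl⟩ := hcover p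
    · rw [← hA.map_nhds_eq, Filter.map_map, hfA', hfA]
      exact (MappingTorus.isOpenMap_mk_pieceOne φ).nhds_le a
    · rw [← hB.map_nhds_eq, Filter.map_map, hfB', hfB]
      exact (MappingTorus.isOpenMap_mk_pieceTwo φ).nhds_le b
  -- injectivity
  have hinj : Injective f := by
    intro p p' hpp'
    obtain ⟨a, rfl⟩ | ⟨b, rfl⟩ := hcover p <;> obtain ⟨a', rfl⟩ | ⟨b', rfl⟩ := hcover p'
    · rw [hfA, hfA] at hpp'
      rw [MappingTorus.injective_mk_pieceOne φ hpp']
    · rw [hfA, hfB] at hpp'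
      exact (hqAB a b').1 hpp'
    · rw [hfB, hfA] at hpp'
      exact ((hqAB a' b).1 hpp'.symm).symm
    · rw [hfB, hfB] at hpp'
      rw [MappingTorus.injective_mk_pieceTwo φ hpp']
  -- surjectivity
  have hsurj : Surjective f := by
    intro z
    obtain ⟨x, t, ⟨ht0, ht1⟩, rfl⟩ := MappingTorus.exists_mk_eq_of_mem_Ico φ z
    rcases ht0.eq_or_lt with rfl | ht0
    · -- level `0`: `[(x, 0)] = [(φ x, 1)]` and `1 ∈ (1/2, 3/2)`
      have h1 : (1 : ℝ) ∈ mappingTorusPieceTwo := by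
        rw [← SetLike.mem_coe, coe_mappingTorusPieceTwo]
        norm_num
      refine ⟨jB (φ x, ⟨1, h1⟩), ?_⟩
      rw [hfB, hqB_def]
      simpa using MappingTorus.mk_apply_add_one φ x 0
    · have ht : t ∈ mappingTorusPieceOne := by
        rw [← SetLike.mem_coe, coe_mappingTorusPieceOne]
        exact ⟨ht0, ht1⟩
      exact ⟨jA (x, ⟨t, ht⟩), hfA _⟩
  exact ⟨((IsOpenEmbedding.of_continuous_injective_isOpenMap hcont hinj hopen).isEmbedding
    ).toHomeomorphOfSurjective hsurj⟩

end Topological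

section Smooth

variable {E H : Type*} [NormedAddCommGroup E] [NormedSpace ℝ E] [TopologicalSpace H]
  {I : ModelWithCorners ℝ E H}
  {ET HT : Type*} [NormedAddCommGroup ET] [NormedSpace ℝ ET] [TopologicalSpace HT]
  {IT : ModelWithCorners ℝ ET HT}
  {M : Type*} [TopologicalSpace M] [ChartedSpace H M]
  {T : Type*} [TopologicalSpace T] [ChartedSpace HT T]

/-- **A smooth mapping torus is homeomorphic to the topological mapping torus.** If `T` is a
smooth mapping torus of the diffeomorphism `φ` (`IsMappingTorusOf IT T φ`) then
`T ≃ₜ MappingTorus φ.toHomeomorph`: the gluing maps are open smooth, hence open topological,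
embeddings, and `nonempty_homeomorph_mappingTorus_of_isOpenEmbedding` applies
(Hatcher, *Algebraic Topology* (2002), Ch. 2 Example 2.48; Cappell–Shaneson, *Some new
four-manifolds*, Ann. of Math. 104 (1976), §1). [cite: HatcherAT2002, Ex. 2.48] [cite: CappellShaneson1976, §1] -/
theorem IsMappingTorusOf.nonempty_homeomorph_mappingTorus {φ : M ≃ₘ⟮I, I⟯ M}
    (h : IsMappingTorusOf IT T φ) : Nonempty (T ≃ₜ MappingTorus φ.toHomeomorph) := by
  obtain ⟨jA, jB, hA, hAo, hB, hBo, hU, hR⟩ := h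
  refine nonempty_homeomorph_mappingTorus_of_isOpenEmbedding φ.toHomeomorph
    ⟨hA.isEmbedding, hAo⟩ ⟨hB.isEmbedding, hBo⟩ hU fun a b => ?_
  rw [hR, Diffeomorph.coe_toHomeomorph]

/-- Discharge of the named fact `nonempty_homeomorph_mappingTorus_of_isMappingTorusOf`
(`MappingTorus.lean`): a smooth mapping torus of `φ` is homeomorphic to
`MappingTorus φ.toHomeomorph` (Hatcher, *Algebraic Topology* (2002), Ch. 2 Example 2.48;
Cappell–Shaneson, Ann. of Math. 104 (1976), §1). [cite: HatcherAT2002, Ex. 2.48] [cite: CappellShaneson1976, §1] -/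
theorem nonempty_homeomorph_mappingTorus_of_isMappingTorusOf_holds :
    nonempty_homeomorph_mappingTorus_of_isMappingTorusOf (I := I) (IT := IT) (M := M) (T := T) :=
  fun h => h.nonempty_homeomorph_mappingTorus

/-- **A smooth mapping torus of a compact manifold is compact**: `T ≃ₜ MappingTorus φ.toHomeomorph`
(`IsMappingTorusOf.nonempty_homeomorph_mappingTorus`) and the topological mapping torus of a
compact space is compact (`MappingTorus.compactSpace_mappingTorus`: it is the continuous image of
`M × [0, 1]`), so compactness transports along the homeomorphism (Cappell–Shaneson, *Some new
four-manifolds*, Ann. of Math. 104 (1976), §1; Hatcher, *Algebraic Topology* (2002), Ch. 2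
Example 2.48). [cite: CappellShaneson1976, §1] [cite: HatcherAT2002, Ex. 2.48] -/
theorem IsMappingTorusOf.compactSpace_of_isMappingTorusOf [CompactSpace M] {φ : M ≃ₘ⟮I, I⟯ M}
    (h : IsMappingTorusOf IT T φ) : CompactSpace T := by
  obtain ⟨e⟩ := h.nonempty_homeomorph_mappingTorus
  exact e.symm.compactSpace

/-- Discharge of the named fact `IsMappingTorusOf.compactSpace` (`MappingTorus.lean`): a smooth
mapping torus of a compact manifold is compact (Cappell–Shaneson, Ann. of Math. 104 (1976), §1).
[cite: CappellShaneson1976, §1] -/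
theorem IsMappingTorusOf.compactSpace_holds :
    IsMappingTorusOf.compactSpace (I := I) (IT := IT) (M := M) (T := T) :=
  fun h => h.compactSpace_of_isMappingTorusOf

end Smooth

/-! ### Uniqueness of the smooth mapping torus up to diffeomorphism -/

section SmoothUnique

variable {E H : Type*} [NormedAddCommGroup E] [NormedSpace ℝ E] [TopologicalSpace H]
  {I : ModelWithCorners ℝ E H}
  {ET HT : Type*} [NormedAddCommGroup ET] [NormedSpace ℝ ET] [TopologicalSpace HT]
  {IT : ModelWithCorners ℝ ET HT}
  {HT' : Type*} [TopologicalSpace HT'] {IT' : ModelWithCorners ℝ ET HT'}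
  {M : Type*} [TopologicalSpace M] [ChartedSpace H M]
  {T : Type*} [TopologicalSpace T] [ChartedSpace HT T]
  {T' : Type*} [TopologicalSpace T'] [ChartedSpace HT' T']

/-- **Discharge of `nonempty_diffeomorph_of_isMappingTorusOf` (uniqueness of the smooth mapping
torus).** Two smooth mapping tori `T`, `T'` of the same diffeomorphism `φ : M ≃ₘ M` are, by
definition (`IsMappingTorusOf`), open gluings of the same cylinders `M × (0, 1)`,
`M × (1/2, 3/2)` along the same relation `mappingTorusRel φ`; hence they are diffeomorphic by the
uniqueness of open gluings `IsOpenGluing.nonempty_diffeomorph`: the comparison map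
`jA a ↦ jA' a`, `jB b ↦ jB' b` is a bijection, smooth in both directions by descent of
smoothness along the open smooth embeddings `jA`, `jB` (`contMDiffAt_of_comp_isImmersionAt`).
This is Kosinski's remark that an identification space `A ∪_g B` carries "the unique structure
for which the projections are diffeomorphisms" onto their images (Kosinski, *Differential
Manifolds*, Ch. VI §1, proof of Theorem (1.1)); the additional locator "I (5.1)" in the docstring
of the fact is Kosinski's definition of a vector field and plays no role. The hypotheses on `M`
(Hausdorff, second countable, `IsManifold`) in the fact are not needed; only `IsManifold` for
`T`, `T'` is used (their preferred charts must lie in the maximal `C^∞` atlases). [cite: Kosinski1993, Ch. VI §1, proof of Thm (1.1)] [cite: CappellShaneson1976, §1] -/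
theorem nonempty_diffeomorph_of_isMappingTorusOf_holds :
    nonempty_diffeomorph_of_isMappingTorusOf (I := I) (IT := IT) (IT' := IT') (M := M) (T := T)
      (T' := T') := by
  intro _ _ _ _ _ φ h h'
  exact IsOpenGluing.nonempty_diffeomorph h h'

end SmoothUnique

end Literature.Topology.FourManifolds
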